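import Literature.NumberTheory.Automorphic.FiniteMultiplicityCriterion
import HarnessLib

/-!
# Orthogonal decompositions of a unitary representation into irreducibles, and the multiplicity
# as the number of equivalent summands
(Dixmier, *C\*-algebras* (1977), 5.4.1–5.4.6; Deitmar–Echterhoff, *Principles of Harmonic
Analysis* (2014), Thm. 9.2.2 with Cor. 6.1.9; Gelbart, *Automorphic forms on adele groups* (1975),
§10, proof of Thm. 10.10)

Topic `NumberTheory/Automorphic`; theorems only (no definition, no named fact, no instance),
extending the vocabulary of `HilbertRepSpectrum` (`ClosedSubrep`, `IsTopIrreducible`,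
`AreUnitarilyEquivalent`, `multiplicity`, `HasMultiplicityOne`) for a unitary representation `π`
of a group `G` on a complex Hilbert space `H`.

An *orthogonal decomposition of `π` into irreducibles* is a family `W : ι → ClosedSubrep π` of
topologically irreducible, pairwise orthogonal closed subrepresentations whose sum is dense
(`(⨆ i, W i)ᗮ = 0`), i.e. `H = ⊕̂ᵢ W i`. This file proves:

* `ClosedSubrep.le_orthogonal_of_not_areUnitarilyEquivalent`,
  `ClosedSubrep.isOrtho_of_not_areUnitarilyEquivalent` — **inequivalent irreducible closed
  subrepresentations of a unitary representation are orthogonal** (Dixmier 5.4.? / Deitmar–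
  Echterhoff Cor. 6.1.9: the compression of the orthogonal projection is an intertwiner out of an
  irreducible, hence a multiple of an isometry onto its — irreducible — image).
* `IsUnitary.isAtomic_of_isDiscretelyDecomposable` — for unitary `π`, "`H` is the closed span of
  its irreducible closed invariant subspaces" (`IsDiscretelyDecomposable`) already implies that
  every non-zero closed subrepresentation contains an irreducible one (the converse of the tree's
  `IsUnitary.isDiscretelyDecomposable_of_isAtomic`, `DiscreteDecompositionCriterion`).
* `IsUnitary.exists_orthogonalDecomposition` — **existence** (Zorn): if every non-zero closed
  subrepresentation contains an irreducible one, there is a set `S` of pairwise orthogonal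
  irreducible closed subrepresentations with dense sum (Dixmier 5.4.1 (ii) ⇒ (i);
  Deitmar–Echterhoff Thm. 9.2.2, first half); `…_of_isDiscretelyDecomposable` combines the two;
  `Set.Pairwise.countable_of_isOrtho` — in a separable space such an `S` is countable.
* `IsUnitary.exists_areUnitarilyEquivalent_of_isTopIrreducible` — every irreducible closed
  subrepresentation of `π` is unitarily equivalent to a member of any orthogonal decomposition.
* `IsUnitary.multiplicity_eq_card` — **the multiplicity is the number of equivalent summands**:
  for every orthogonal decomposition `W` into irreducibles and every `σ`,
  `multiplicity π σ = #{i | W i ≃ σ}` in `ℕ∞` (`ENat.card`); in particular this number does not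
  depend on the decomposition (`IsUnitary.card_eq_card_of_orthogonalDecomposition`; Dixmier
  5.4.6, Deitmar–Echterhoff Thm. 9.2.2: "the multiplicities are uniquely determined"). The
  inequality `≤` is the content: a finite orthogonal family of `k` irreducibles `V₁, …, V_k ≃ σ`
  has `k ≤ m = #{i | W i ≃ σ}`. Proof: fix `0 ≠ x₀ ∈ V₁` and isometric intertwiners
  `b_l : V₁ ≃ V_l`, `a_i : V₁ ≃ W i`; the vectors `y_l = b_l x₀ ∈ V_l` are non-zero and pairwise
  orthogonal, and each lies in the span of the `m` vectors `a_i x₀`: `y_l` is orthogonal to every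
  `W j ≄ σ` (first item), so `y_l = Σ_{W i ≃ σ} P_{W i} y_l` (the sum of the `W i` is dense), and
  `P_{W i} ∘ b_l : V₁ → W i` is an intertwiner between equivalent irreducibles, so
  `a_i⁻¹ P_{W i} b_l ∈ End_G(V₁) = ℂ` (Schur's lemma, `IsTopIrreducible.exists_eq_algebraMap_of_commute`
  of `HilbertRepSchur`) and `P_{W i} y_l = c_{l i} a_i x₀`. Hence `k ≤ m` by linear independence
  of non-zero orthogonal vectors.
* `IsUnitary.hasMultiplicityOne_iff_pairwise_not_areUnitarilyEquivalent` — **`π` has multiplicity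
  one iff the members of an (equivalently: every) orthogonal decomposition into irreducibles are
  pairwise inequivalent** (with the tree's `hasMultiplicityOne_iff_multiplicity_le_one_holds`).

Why this is here. Multiplicity one for `L²(D_𝔸ˣ ⧸ ℝ_{>0} Dˣ)`, `D` a division quaternion
algebra (`Literature.NumberTheory.Automorphic.multiplicity_one_quaternionUnits`, Gelbart (1975)
Thm. 10.10, and through it `strong_multiplicity_one_quaternionUnits`), is proved in the source by
comparing the spectral side `Σ_π m(π) tr π(f ⋆ f^*)` of the trace formula for `D^×` (Gelbart
(10.12)–(10.14)) with that of `GL₂`, the `m(π)` being the multiplicities *in a fixed orthogonal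
decomposition* `R'_ψ = ⊕ π^j` of `L²` (Gelbart p. 151); the conclusion "`m(π') ≤ 1`" is a
statement about one decomposition, while `HasMultiplicityOne` / `multiplicity` of
`HilbertRepSpectrum` quantify over *all* irreducible closed invariant subspaces. The last two
items are exactly the bridge; the existence statement supplies the decomposition of
`L²(D_𝔸ˣ ⧸ ℝ_{>0} Dˣ)` (discretely decomposable: `QuaternionUnitsSpectrumDiscrete`) over which
the Hilbert–Schmidt norm `Σ_i ‖R(f) e_i‖²` of `QuaternionUnitsTraceHS` is to be summed.

## References

* J. Dixmier, *C\*-algebras*, North-Holland (1977), 5.4.1–5.4.6 [Dixmier1977].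
* A. Deitmar, S. Echterhoff, *Principles of Harmonic Analysis*, 2nd ed. (2014), Cor. 6.1.9,
  Thm. 9.2.2 [DeitmarEchterhoff2014].
* S. Gelbart, *Automorphic forms on adele groups*, Ann. of Math. Studies 83 (1975), §10,
  pp. 151–153 and Thm. 10.10, p. 158 [Gelbart1975].
-/

noncomputable section

open scoped InnerProductSpace
open Topology

namespace ContRepresentation

/-! ### Closed spans: the missing half of the Galois connection -/

section TopologicalModule

variable {R G V : Type*} [Ring R] [Monoid G] [AddCommGroup V] [TopologicalSpace V]
  [IsTopologicalAddGroup V] [Module R V] [ContinuousConstSMul R V] {π : ContRepresentation R G V}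

/-- The closed span of a family of closed subrepresentations is below every closed
subrepresentation containing each member (`le_iSupClosure` is the other half).
(Dixmier (1977), §13.1.2.) [cite: Dixmier1977, §13.1.2] -/
theorem ClosedSubrep.iSupClosure_le {S : Set (ClosedSubrep π)} {Z : ClosedSubrep π}
    (h : ∀ W ∈ S, W ≤ Z) : ClosedSubrep.iSupClosure S ≤ Z := by
  intro v hv
  change v ∈ (⨆ W ∈ S, (W : ClosedSubrep π).toSubmodule).topologicalClosure at hv
  have hle : (⨆ W ∈ S, (W : ClosedSubrep π).toSubmodule) ≤ Z.toSubmodule :=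
    iSup₂_le fun W hW => ClosedSubrep.toSubmodule_le_iff.mpr (h W hW)
  exact (Submodule.topologicalClosure_minimal _ hle Z.isClosed) hv

end TopologicalModule

section Hilbert

variable {G H : Type*} [Group G] [NormedAddCommGroup H] [InnerProductSpace ℂ H] [CompleteSpace H]
  {π : ContRepresentation ℂ G H}

/-! ### Small order-theoretic complements on `ClosedSubrep π` -/

/-- A closed subrepresentation contained in `U` and in `Uᗮ` is zero. [folklore] -/
theorem ClosedSubrep.eq_bot_of_le_of_le_orthogonal (hπ : π.IsUnitary) {U A : ClosedSubrep π}
    (h₁ : A ≤ U) (h₂ : A ≤ U.orthogonal hπ) : A = ⊥ := by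
  ext v
  rw [ClosedSubrep.mem_bot]
  refine ⟨fun hv => ?_, ?_⟩
  · exact inner_self_eq_zero.mp (Submodule.inner_right_of_mem_orthogonal (K := U.toSubmodule)
      (h₁ hv) (h₂ hv))
  · rintro rfl
    exact A.toSubmodule.zero_mem

/-- `⊥ᗮ = ⊤` for closed subrepresentations. [folklore] -/
theorem ClosedSubrep.orthogonal_bot (hπ : π.IsUnitary) :
    (⊥ : ClosedSubrep π).orthogonal hπ = ⊤ := by
  ext v
  simp only [ClosedSubrep.mem_orthogonal_iff, ClosedSubrep.mem_bot, ClosedSubrep.mem_top,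
    iff_true]
  rintro u rfl
  exact inner_zero_left v

/-- A closed subrepresentation with zero orthogonal complement is everything. [folklore] -/
theorem ClosedSubrep.eq_top_of_orthogonal_eq_bot (hπ : π.IsUnitary) {D : ClosedSubrep π}
    (h : D.orthogonal hπ = ⊥) : D = ⊤ := by
  rw [← ClosedSubrep.orthogonal_orthogonal hπ D, h, ClosedSubrep.orthogonal_bot hπ]

omit [CompleteSpace H] in
/-- An irreducible closed subrepresentation is non-zero. [folklore] -/
theorem ClosedSubrep.ne_bot_of_isTopIrreducible {W : ClosedSubrep π}
    (hW : W.toContRep.IsTopIrreducible) : W ≠ ⊥ :=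
  ((ClosedSubrep.isTopIrreducible_toContRep_iff W).mp hW).1

omit [CompleteSpace H] in
/-- An irreducible closed subrepresentation contains a non-zero vector. [folklore] -/
theorem ClosedSubrep.exists_mem_ne_zero_of_isTopIrreducible {W : ClosedSubrep π}
    (hW : W.toContRep.IsTopIrreducible) : ∃ v ∈ W, v ≠ 0 := by
  by_contra h
  push Not at h
  apply ClosedSubrep.ne_bot_of_isTopIrreducible hW
  ext v
  rw [ClosedSubrep.mem_bot]
  exact ⟨h v, by rintro rfl; exact W.toSubmodule.zero_mem⟩

/-! ### Inequivalent irreducible subrepresentations are orthogonal -/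

/-- **Inequivalent irreducible closed subrepresentations of a unitary representation are
orthogonal**, in the form `V ≤ Wᗮ` (Deitmar–Echterhoff (2014), Cor. 6.1.9; Dixmier (1977), 5.4):
if `V ≰ Wᗮ`, the isometric part of the compressed projection `P_W|_V`
(`ClosedSubrep.exists_le_orthogonal_areUnitarilyEquivalent`, applied to `Wᗮ`) maps `V` onto an
irreducible `W'' ≤ Wᗮᗮ = W`, and `W'' = W` because `W` is irreducible; so `V ≃ W`.
[cite: DeitmarEchterhoff2014, Cor. 6.1.9] -/
theorem ClosedSubrep.le_orthogonal_of_not_areUnitarilyEquivalent (hπ : π.IsUnitary)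
    {V W : ClosedSubrep π} (hV : V.toContRep.IsTopIrreducible) (hW : W.toContRep.IsTopIrreducible)
    (hne : ¬ AreUnitarilyEquivalent V.toContRep W.toContRep) : V ≤ W.orthogonal hπ := by
  by_contra hle
  obtain ⟨W'', hW''le, hW''e⟩ :=
    ClosedSubrep.exists_le_orthogonal_areUnitarilyEquivalent hπ (W.orthogonal hπ) V hV hle
  rw [ClosedSubrep.orthogonal_orthogonal] at hW''le
  obtain ⟨e, he⟩ := hW''e
  have hW''irr : W''.toContRep.IsTopIrreducible := (isTopIrreducible_congr e).mp hV
  rcases ((ClosedSubrep.isTopIrreducible_toContRep_iff W).mp hW).2 W'' hW''le with h | h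
  · exact ClosedSubrep.ne_bot_of_isTopIrreducible hW''irr h
  · subst h
    exact hne ⟨e, he⟩

/-- `V ≤ Wᗮ` as orthogonality of the underlying subspaces. [folklore] -/
theorem ClosedSubrep.isOrtho_of_le_orthogonal (hπ : π.IsUnitary) {V W : ClosedSubrep π}
    (h : V ≤ W.orthogonal hπ) : V.toSubmodule ⟂ W.toSubmodule := by
  rw [Submodule.isOrtho_iff_le]
  exact fun v hv => h hv

/-- **Inequivalent irreducible closed subrepresentations of a unitary representation are
orthogonal** (Deitmar–Echterhoff (2014), Cor. 6.1.9; Dixmier (1977), 5.4).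
[cite: DeitmarEchterhoff2014, Cor. 6.1.9] -/
theorem ClosedSubrep.isOrtho_of_not_areUnitarilyEquivalent (hπ : π.IsUnitary)
    {V W : ClosedSubrep π} (hV : V.toContRep.IsTopIrreducible) (hW : W.toContRep.IsTopIrreducible)
    (hne : ¬ AreUnitarilyEquivalent V.toContRep W.toContRep) : V.toSubmodule ⟂ W.toSubmodule :=
  ClosedSubrep.isOrtho_of_le_orthogonal hπ
    (ClosedSubrep.le_orthogonal_of_not_areUnitarilyEquivalent hπ hV hW hne)

/-! ### Atomicity from discrete decomposability -/

/-- For unitary `π`, if the irreducible closed subrepresentations span a dense subspace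
(`IsDiscretelyDecomposable`) then **every non-zero closed subrepresentation `U` contains an
irreducible one**: otherwise no irreducible `W` meets `U` isometrically, i.e. (by the isometric
part of `P_U|_W`, `ClosedSubrep.exists_le_orthogonal_areUnitarilyEquivalent`) every irreducible
`W` lies in `Uᗮ`, hence so does their closed span `H`, and `U = 0` (Dixmier (1977), 5.4.1).
[cite: Dixmier1977, 5.4.1] -/
theorem IsUnitary.exists_isTopIrreducible_le_of_isDiscretelyDecomposable (hπ : π.IsUnitary)
    (hd : π.IsDiscretelyDecomposable) {U : ClosedSubrep π} (hU : U ≠ ⊥) :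
    ∃ W : ClosedSubrep π, W.toContRep.IsTopIrreducible ∧ W ≤ U := by
  by_contra hcon
  push Not at hcon
  apply hU
  have hall : ∀ W : ClosedSubrep π, W.toContRep.IsTopIrreducible → W ≤ U.orthogonal hπ := by
    intro W hW
    by_contra hle
    obtain ⟨W'', hW''le, hW''e⟩ :=
      ClosedSubrep.exists_le_orthogonal_areUnitarilyEquivalent hπ (U.orthogonal hπ) W hW hle
    rw [ClosedSubrep.orthogonal_orthogonal] at hW''le
    obtain ⟨e, -⟩ := hW''e
    exact hcon W'' ((isTopIrreducible_congr e).mp hW) hW''le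
  have htop : (⊤ : ClosedSubrep π) ≤ U.orthogonal hπ := by
    rw [← show π.discretePart = ⊤ from hd]
    exact ClosedSubrep.iSupClosure_le fun W hW => hall W hW
  exact ClosedSubrep.eq_bot_of_le_of_le_orthogonal hπ le_rfl
    (fun v _ => htop (ClosedSubrep.mem_top v))

/-- For unitary `π`, **discrete decomposability implies atomicity** of the ordered set of closed
subrepresentations (the converse of `IsUnitary.isDiscretelyDecomposable_of_isAtomic`).
[cite: Dixmier1977, 5.4.1] -/
theorem IsUnitary.isAtomic_of_isDiscretelyDecomposable (hπ : π.IsUnitary)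
    (hd : π.IsDiscretelyDecomposable) : IsAtomic (ClosedSubrep π) := by
  refine ⟨fun U => or_iff_not_imp_left.mpr fun hU => ?_⟩
  obtain ⟨W, hW, hle⟩ := hπ.exists_isTopIrreducible_le_of_isDiscretelyDecomposable hd hU
  exact ⟨W, (ClosedSubrep.isTopIrreducible_toContRep_iff_isAtom W).mp hW, hle⟩

/-! ### Existence of orthogonal decompositions into irreducibles (Zorn) -/

/-- **Existence of an orthogonal decomposition into irreducibles** (Dixmier (1977), 5.4.1;
Deitmar–Echterhoff (2014), Thm. 9.2.2, first half; Gelfand–Graev–Piatetski-Shapiro, Ch. 1 §2). If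
`π` is unitary and every non-zero closed subrepresentation contains an irreducible one
(`IsAtomic (ClosedSubrep π)`, e.g. from compact operators, `IsUnitary.isAtomic_of_isCompactOperator`),
then there is a set `S` of topologically irreducible, pairwise orthogonal closed
subrepresentations whose closed span is `H`. Proof: a maximal pairwise orthogonal set of
irreducibles (Zorn); if its closed span `D` were proper, `Dᗮ ≠ 0` would contain an irreducible,
orthogonal to every member. [cite: Dixmier1977, 5.4.1] -/
theorem IsUnitary.exists_orthogonalDecomposition (hπ : π.IsUnitary)
    (hA : IsAtomic (ClosedSubrep π)) :
    ∃ S : Set (ClosedSubrep π), (∀ W ∈ S, W.toContRep.IsTopIrreducible) ∧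
      S.Pairwise (fun W W' => W.toSubmodule ⟂ W'.toSubmodule) ∧
      ClosedSubrep.iSupClosure S = ⊤ := by
  classical
  set P : Set (Set (ClosedSubrep π)) := {S | (∀ W ∈ S, W.toContRep.IsTopIrreducible) ∧
    S.Pairwise fun W W' => W.toSubmodule ⟂ W'.toSubmodule} with hP
  -- Zorn: chains in `P` are bounded by their union
  obtain ⟨M, hM⟩ : ∃ M, Maximal (· ∈ P) M := by
    refine zorn_subset P fun c hcP hc => ⟨⋃₀ c, ⟨?_, ?_⟩, fun s hs => Set.subset_sUnion_of_mem hs⟩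
    · rintro W ⟨s, hs, hW⟩
      exact (hcP hs).1 W hW
    · rintro W ⟨s, hs, hW⟩ W' ⟨s', hs', hW'⟩ hne
      rcases eq_or_ne s s' with rfl | hss
      · exact (hcP hs).2 hW hW' hne
      · rcases hc hs hs' hss with h | h
        · exact (hcP hs').2 (h hW) hW' hne
        · exact (hcP hs).2 hW (h hW') hne
  have hMP : M ∈ P := hM.prop
  refine ⟨M, hMP.1, hMP.2, ?_⟩
  -- maximality forces the closed span `D` to be everything
  set D : ClosedSubrep π := ClosedSubrep.iSupClosure M with hD
  by_contra htop
  have hDo : D.orthogonal hπ ≠ ⊥ := fun h0 =>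
    htop (ClosedSubrep.eq_top_of_orthogonal_eq_bot hπ h0)
  obtain ⟨A, hAatom, hAle⟩ := (IsAtomic.eq_bot_or_exists_atom_le (D.orthogonal hπ)).resolve_left hDo
  have hAirr : A.toContRep.IsTopIrreducible :=
    (ClosedSubrep.isTopIrreducible_toContRep_iff_isAtom A).mpr hAatom
  have hAM : A ∉ M := fun hAM =>
    hAatom.1 (ClosedSubrep.eq_bot_of_le_of_le_orthogonal hπ (ClosedSubrep.le_iSupClosure hAM) hAle)
  have hins : insert A M ∈ P := by
    refine ⟨?_, Set.pairwise_insert.mpr ⟨hMP.2, fun W hW _ => ?_⟩⟩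
    · rintro W (rfl | hW)
      exacts [hAirr, hMP.1 W hW]
    · have hWD : W ≤ D := ClosedSubrep.le_iSupClosure hW
      have h : W.toSubmodule ⟂ A.toSubmodule :=
        (ClosedSubrep.isOrtho_of_le_orthogonal hπ hAle).symm.mono_left
          (ClosedSubrep.toSubmodule_le_iff.mpr hWD)
      exact ⟨h.symm, h⟩
  exact hAM ((hM.eq_of_subset hins (Set.subset_insert A M)).symm ▸ Set.mem_insert A M)

/-- **A discretely decomposable unitary representation is an orthogonal sum of irreducibles**
(Dixmier (1977), 5.4.1 (ii) ⇒ (i); Deitmar–Echterhoff (2014), Thm. 9.2.2):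
`exists_orthogonalDecomposition` with `isAtomic_of_isDiscretelyDecomposable`.
[cite: Dixmier1977, 5.4.1] -/
theorem IsUnitary.exists_orthogonalDecomposition_of_isDiscretelyDecomposable (hπ : π.IsUnitary)
    (hd : π.IsDiscretelyDecomposable) :
    ∃ S : Set (ClosedSubrep π), (∀ W ∈ S, W.toContRep.IsTopIrreducible) ∧
      S.Pairwise (fun W W' => W.toSubmodule ⟂ W'.toSubmodule) ∧
      ClosedSubrep.iSupClosure S = ⊤ :=
  hπ.exists_orthogonalDecomposition (hπ.isAtomic_of_isDiscretelyDecomposable hd)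

omit [CompleteSpace H] in
/-- The closed span of `S` is `⊤` iff the sum `⨆ W ∈ S, W` has zero orthogonal complement
(Mathlib `Submodule.topologicalClosure_eq_top_iff`). [folklore] -/
theorem ClosedSubrep.iSupClosure_eq_top_iff [CompleteSpace H] (S : Set (ClosedSubrep π)) :
    ClosedSubrep.iSupClosure S = ⊤ ↔ (⨆ W ∈ S, (W : ClosedSubrep π).toSubmodule)ᗮ = ⊥ := by
  rw [← Submodule.topologicalClosure_eq_top_iff]
  constructor
  · intro h
    exact congrArg (fun W : ClosedSubrep π => W.toSubmodule) h
  · intro h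
    apply ClosedSubrep.ext
    intro v
    refine ⟨fun _ => ClosedSubrep.mem_top v, fun _ => ?_⟩
    change v ∈ (⨆ W ∈ S, (W : ClosedSubrep π).toSubmodule).topologicalClosure
    rw [h]
    trivial

omit [CompleteSpace H] in
/-- **In a separable Hilbert space a family of pairwise orthogonal non-zero closed subspaces is
countable**: unit vectors `u_W ∈ W` are at mutual distance `√2`, so the balls `B(u_W, 1/2)` are
disjoint non-empty open sets (Mathlib `Set.PairwiseDisjoint.countable_of_isOpen`). [folklore] -/
theorem _root_.Set.Pairwise.countable_of_isOrtho [TopologicalSpace.SeparableSpace H]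
    {S : Set (ClosedSubrep π)} (hS : S.Pairwise fun W W' => W.toSubmodule ⟂ W'.toSubmodule)
    (hne : ∀ W ∈ S, W ≠ ⊥) : S.Countable := by
  classical
  -- a unit vector in each member
  have hex : ∀ W : ClosedSubrep π, W ∈ S → ∃ u ∈ W, ‖u‖ = 1 := by
    intro W hW
    have hW : ∃ v ∈ W, v ≠ 0 := by
      by_contra h
      push Not at h
      apply hne W hW
      ext v
      rw [ClosedSubrep.mem_bot]
      exact ⟨h v, by rintro rfl; exact W.toSubmodule.zero_mem⟩
    obtain ⟨v, hv, hv0⟩ := hW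
    refine ⟨(‖v‖⁻¹ : ℂ) • v, W.toSubmodule.smul_mem _ hv, ?_⟩
    rw [norm_smul, norm_inv, Complex.norm_real, Real.norm_eq_abs, abs_norm,
      inv_mul_cancel₀ (norm_ne_zero_iff.mpr hv0)]
  choose! u huW hu1 using hex
  -- distinct members give orthogonal unit vectors, at distance `> 1`
  have hfar : ∀ W ∈ S, ∀ W' ∈ S, W ≠ W' → 1 < ‖u W - u W'‖ := by
    intro W hW W' hW' hWW'
    have h0 : ⟪u W, u W'⟫_ℂ = 0 := (hS hW hW' hWW').inner_eq (huW W hW) (huW W' hW')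
    have hsq : ‖u W - u W'‖ ^ 2 = 2 := by
      rw [@norm_sub_sq ℂ, hu1 W hW, hu1 W' hW', h0]
      norm_num
    nlinarith [norm_nonneg (u W - u W'), hsq]
  have hdisj : S.PairwiseDisjoint fun W => Metric.ball (u W) (1 / 2) := by
    intro W hW W' hW' hWW'
    refine Metric.ball_disjoint_ball ?_
    rw [dist_eq_norm]
    linarith [hfar W hW W' hW' hWW']
  exact hdisj.countable_of_isOpen (fun _ _ => Metric.isOpen_ball)
    fun W _ => ⟨u W, Metric.mem_ball_self (by norm_num)⟩


/-! ### Every irreducible is equivalent to a summand -/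

variable {ι : Type*}

/-- **Every irreducible closed subrepresentation of `π` is unitarily equivalent to a member of
any orthogonal decomposition into irreducibles** (Dixmier (1977), 5.4.1 and 5.4.4): by
`isOrtho_of_not_areUnitarilyEquivalent` an irreducible `V` inequivalent to every `W i` would be
orthogonal to their dense sum. Orthogonality of the `W i` is not needed. [cite: Dixmier1977, 5.4.4] -/
theorem IsUnitary.exists_areUnitarilyEquivalent_of_isTopIrreducible (hπ : π.IsUnitary)
    {W : ι → ClosedSubrep π} (hirr : ∀ i, (W i).toContRep.IsTopIrreducible)
    (hdense : (⨆ i, (W i).toSubmodule)ᗮ = ⊥) {V : ClosedSubrep π}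
    (hV : V.toContRep.IsTopIrreducible) :
    ∃ i, AreUnitarilyEquivalent V.toContRep (W i).toContRep := by
  by_contra h
  push Not at h
  apply ClosedSubrep.ne_bot_of_isTopIrreducible hV
  ext v
  rw [ClosedSubrep.mem_bot]
  refine ⟨fun hv => ?_, by rintro rfl; exact V.toSubmodule.zero_mem⟩
  have hv' : v ∈ (⨆ i, (W i).toSubmodule)ᗮ := by
    rw [← Submodule.iInf_orthogonal, Submodule.mem_iInf]
    intro i
    exact (ClosedSubrep.isOrtho_of_not_areUnitarilyEquivalent hπ hV (hirr i) (h i)).le hv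
  rw [hdense] at hv'
  exact (Submodule.mem_bot ℂ).mp hv'

omit [CompleteSpace H] in
/-- The members of an orthogonal family of irreducible (more generally: non-zero) closed
subrepresentations are pairwise distinct. [folklore] -/
theorem ClosedSubrep.injective_of_pairwise_isOrtho {W : ι → ClosedSubrep π}
    (hirr : ∀ i, (W i).toContRep.IsTopIrreducible)
    (horth : Pairwise fun i j => (W i).toSubmodule ⟂ (W j).toSubmodule) :
    Function.Injective W := by
  intro i j hij
  by_contra hne
  have h : (W i).toSubmodule ⟂ (W j).toSubmodule := horth hne
  rw [hij] at h
  refine ClosedSubrep.ne_bot_of_isTopIrreducible (hirr j) ?_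
  ext v
  rw [ClosedSubrep.mem_bot]
  exact ⟨fun hv => inner_self_eq_zero.mp (h.inner_eq hv hv),
    by rintro rfl; exact (W j).toSubmodule.zero_mem⟩

omit [CompleteSpace H] in
/-- **Lower bound**: finitely many members `W i ≃ σ`, `i ∈ F`, of an orthogonal family of
irreducibles witness `multiplicity π σ ≥ #F` (they are pairwise distinct,
`injective_of_pairwise_isOrtho`). [cite: Dixmier1977, 5.4.6] -/
theorem le_multiplicity_of_pairwise_isOrtho {W : ι → ClosedSubrep π}
    (hirr : ∀ i, (W i).toContRep.IsTopIrreducible)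
    (horth : Pairwise fun i j => (W i).toSubmodule ⟂ (W j).toSubmodule)
    {H' : Type*} [SeminormedAddCommGroup H'] [Module ℂ H'] {σ : ContRepresentation ℂ G H'}
    (F : Finset ι) (hF : ∀ i ∈ F, AreUnitarilyEquivalent (W i).toContRep σ) :
    (F.card : ℕ∞) ≤ π.multiplicity σ := by
  classical
  have hinj := ClosedSubrep.injective_of_pairwise_isOrtho hirr horth
  unfold multiplicity
  refine le_iSup_of_le (F.image W) (le_iSup_of_le ?_ (le_iSup_of_le ?_ ?_))
  · intro V hV
    obtain ⟨i, hi, rfl⟩ := Finset.mem_image.mp hV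
    exact ⟨hirr i, hF i hi⟩
  · intro V hV V' hV' hne
    obtain ⟨i, -, rfl⟩ := Finset.mem_image.mp (Finset.mem_coe.mp hV)
    obtain ⟨j, -, rfl⟩ := Finset.mem_image.mp (Finset.mem_coe.mp hV')
    exact horth fun h => hne (h ▸ rfl)
  · rw [Finset.card_image_of_injective F hinj]

/-! ### The multiplicity is the number of equivalent summands -/

/-- **Upper bound (the counting argument).** Let `W` be an orthogonal decomposition of the
unitary `π` into irreducibles and `s` a finite family of pairwise orthogonal irreducible closed
subrepresentations each unitarily equivalent to `σ`. Then `#s ≤ #{i | W i ≃ σ}` when the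
latter is finite. With `0 ≠ x₀ ∈ V₀ ∈ s` and isometric intertwiners `b_V : V₀ ≃ V` (`V ∈ s`),
`a_i : V₀ ≃ W i` (`W i ≃ σ`): the vectors `y_V = b_V x₀` are non-zero, pairwise orthogonal, and
lie in the span of the `a_i x₀` — `y_V ⟂ W j` for `W j ≄ σ`, so `y_V = Σ_{W i ≃ σ} P_{W i} y_V`
by density, and `a_i⁻¹ ∘ P_{W i} ∘ b_V ∈ End_G(V₀)` is a scalar `c_{V,i}` by Schur's lemma
(`IsTopIrreducible.exists_eq_algebraMap_of_commute`), i.e. `P_{W i} y_V = c_{V,i} a_i x₀`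
(Dixmier (1977), 5.4.5–5.4.6; Deitmar–Echterhoff (2014), Thm. 9.2.2). [cite: Dixmier1977, 5.4.6] -/
theorem IsUnitary.card_le_card_of_orthogonalDecomposition (hπ : π.IsUnitary)
    {W : ι → ClosedSubrep π} (hirr : ∀ i, (W i).toContRep.IsTopIrreducible)
    (horth : Pairwise fun i j => (W i).toSubmodule ⟂ (W j).toSubmodule)
    (hdense : (⨆ i, (W i).toSubmodule)ᗮ = ⊥)
    {H' : Type*} [SeminormedAddCommGroup H'] [Module ℂ H'] (σ : ContRepresentation ℂ G H')
    [Fintype {i // AreUnitarilyEquivalent (W i).toContRep σ}]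
    (s : Finset (ClosedSubrep π))
    (hs : ∀ V ∈ s, V.toContRep.IsTopIrreducible ∧ AreUnitarilyEquivalent V.toContRep σ)
    (ho : (s : Set (ClosedSubrep π)).Pairwise fun V V' => V.toSubmodule ⟂ V'.toSubmodule) :
    s.card ≤ Fintype.card {i // AreUnitarilyEquivalent (W i).toContRep σ} := by
  classical
  rcases s.eq_empty_or_nonempty with rfl | ⟨V₀, hV₀⟩
  · simp
  -- a reference irreducible `V₀ ∈ s` and `0 ≠ x₀ ∈ V₀`
  obtain ⟨hV₀irr, hV₀σ⟩ := hs V₀ hV₀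
  obtain ⟨x₀, hx₀V, hx₀⟩ := ClosedSubrep.exists_mem_ne_zero_of_isTopIrreducible hV₀irr
  set x₀' : V₀.toSubmodule := ⟨x₀, hx₀V⟩ with hx₀'
  -- isometric intertwiners `b_V : V₀ ≃ V` and `a_i : V₀ ≃ W i`
  have hb : ∀ V : ↥s, ∃ e : V₀.toContRep.Equiv (V : ClosedSubrep π).toContRep, Isometry e :=
    fun V => hV₀σ.trans (hs V V.2).2.symm
  choose b hbiso using hb
  have ha : ∀ i : {i // AreUnitarilyEquivalent (W i).toContRep σ},
      ∃ e : V₀.toContRep.Equiv (W i.1).toContRep, Isometry e :=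
    fun i => hV₀σ.trans i.2.symm
  choose a _haiso using ha
  -- the vectors `y_V = b_V x₀ ∈ V` and `z_i = a_i x₀ ∈ W i`
  let y : ↥s → H := fun V => ((b V x₀' : (V : ClosedSubrep π).toSubmodule) : H)
  let z : {i // AreUnitarilyEquivalent (W i).toContRep σ} → H :=
    fun i => ((a i x₀' : (W i.1).toSubmodule) : H)
  have hyV : ∀ V : ↥s, y V ∈ (V : ClosedSubrep π) := fun V => (b V x₀').2
  have hynorm : ∀ V : ↥s, ‖y V‖ = ‖x₀‖ := fun V =>
    (hbiso V).norm_map_of_map_zero (map_zero _) x₀'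
  have hy0 : ∀ V : ↥s, y V ≠ 0 := fun V h =>
    hx₀ (norm_eq_zero.mp (by rw [← hynorm V, h, norm_zero]))
  have hyorth : Pairwise fun V V' : ↥s => ⟪y V, y V'⟫_ℂ = 0 := fun V V' hne =>
    (ho V.2 V'.2 fun h => hne (Subtype.ext h)).inner_eq (hyV V) (hyV V')
  -- Schur: `P_{W i} (b_V x) = c • a_i x`
  have hschur : ∀ (V : ↥s) (i : {i // AreUnitarilyEquivalent (W i).toContRep σ}), ∃ c : ℂ,
      ∀ x : V₀.toSubmodule, (W i.1).toSubmodule.starProjection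
        ((b V x : (V : ClosedSubrep π).toSubmodule) : H) = c • ((a i x : (W i.1).toSubmodule) : H) := by
    intro V i
    obtain ⟨hVirr, -⟩ := hs V V.2
    -- `T = P_{W i} ∘ ι_V ∘ b_V : V₀ → W i` intertwines
    let T : V₀.toSubmodule →L[ℂ] (W i.1).toSubmodule :=
      (W i.1).toSubmodule.orthogonalProjectionOnto ∘L
        ((V : ClosedSubrep π).toSubmodule.subtypeL ∘L
          ((b V).toContinuousLinearEquiv : V₀.toSubmodule →L[ℂ] (V : ClosedSubrep π).toSubmodule))
    have hTapply : ∀ x : V₀.toSubmodule, T x = (W i.1).toSubmodule.orthogonalProjectionOnto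
        ((b V x : (V : ClosedSubrep π).toSubmodule) : H) := fun x => rfl
    have hT : ∀ (g : G) (x : V₀.toSubmodule),
        T (V₀.toContRep g x) = (W i.1).toContRep g (T x) := by
      intro g x
      have hbx : b V (V₀.toContRep g x) = (V : ClosedSubrep π).toContRep g (b V x) :=
        (b V).toContIntertwiningMap.isIntertwining g x
      rw [hTapply, hTapply, hbx]
      exact ClosedSubrep.orthogonalProjectionOnto_toContRep_apply hπ _ _ g _
    -- `S = a_i⁻¹ ∘ T ∈ End_G(V₀)` is a scalar
    let S : V₀.toSubmodule →L[ℂ] V₀.toSubmodule :=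
      ((a i).symm.toContinuousLinearEquiv : (W i.1).toSubmodule →L[ℂ] V₀.toSubmodule) ∘L T
    have hSapply : ∀ x : V₀.toSubmodule, S x = (a i).symm (T x) := fun x => rfl
    have hcomm : ∀ g : G, Commute (V₀.toContRep g) S := by
      intro g
      change V₀.toContRep g * S = S * V₀.toContRep g
      apply ContinuousLinearMap.ext
      intro x
      change V₀.toContRep g (S x) = S (V₀.toContRep g x)
      have hax : (a i).symm ((W i.1).toContRep g (T x)) = V₀.toContRep g ((a i).symm (T x)) :=
        (a i).symm.toContIntertwiningMap.isIntertwining g (T x)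
      rw [hSapply, hSapply, hT g x, hax]
    obtain ⟨c, hc⟩ := hV₀irr.exists_eq_algebraMap_of_commute (hπ.toContRep V₀) hcomm
    refine ⟨c, fun x => ?_⟩
    have h1 : S x = c • x := by
      rw [hc, ContinuousLinearMap.algebraMap_apply]
    have h2 : T x = c • a i x := by
      have h := congrArg (a i) h1
      rw [hSapply, Equiv.apply_symm_apply, map_smul] at h
      exact h
    rw [Submodule.starProjection_apply, ← hTapply, h2, Submodule.coe_smul]
  -- each `y_V` lies in the span of the `z_i`
  have hmem : ∀ V : ↥s, y V ∈ Submodule.span ℂ (Set.range z) := by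
    intro V
    obtain ⟨hVirr, hVσ⟩ := hs V V.2
    -- `y_V = Σ_{W i ≃ σ} P_{W i} y_V`: the difference is orthogonal to every `W j`
    have hsum : y V = ∑ i : {i // AreUnitarilyEquivalent (W i).toContRep σ},
        (W i.1).toSubmodule.starProjection (y V) := by
      rw [← sub_eq_zero]
      have hr : (y V - ∑ i : {i // AreUnitarilyEquivalent (W i).toContRep σ},
          (W i.1).toSubmodule.starProjection (y V)) ∈ (⨆ j, (W j).toSubmodule)ᗮ := by
        rw [← Submodule.iInf_orthogonal, Submodule.mem_iInf]
        intro j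
        rw [Submodule.mem_orthogonal]
        intro w hw
        rw [inner_sub_right, inner_sum]
        by_cases hj : AreUnitarilyEquivalent (W j).toContRep σ
        · rw [Finset.sum_eq_single (⟨j, hj⟩ : {i // AreUnitarilyEquivalent (W i).toContRep σ})]
          · rw [sub_eq_zero, ← Submodule.inner_starProjection_left_eq_right,
              Submodule.starProjection_eq_self_iff.mpr hw]
          · intro i _ hij
            have hne : j ≠ i.1 := fun h => hij (Subtype.ext h.symm)
            exact (horth hne).inner_eq hw (Submodule.starProjection_apply_mem _ _)
          · intro h
            exact absurd (Finset.mem_univ _) h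
        · have h0 : ⟪w, y V⟫_ℂ = 0 := by
            have hVj : ¬ AreUnitarilyEquivalent (V : ClosedSubrep π).toContRep (W j).toContRep :=
              fun h => hj (h.symm.trans hVσ)
            exact (ClosedSubrep.isOrtho_of_not_areUnitarilyEquivalent hπ hVirr (hirr j)
              hVj).symm.inner_eq hw (hyV V)
          rw [h0, zero_sub, neg_eq_zero]
          refine Finset.sum_eq_zero fun i _ => ?_
          have hne : j ≠ i.1 := fun h => hj (by rw [h]; exact i.2)
          exact (horth hne).inner_eq hw (Submodule.starProjection_apply_mem _ _)
      rw [hdense] at hr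
      exact (Submodule.mem_bot ℂ).mp hr
    rw [hsum]
    refine Submodule.sum_mem _ fun i _ => ?_
    obtain ⟨c, hc⟩ := hschur V i
    rw [show y V = ((b V x₀' : (V : ClosedSubrep π).toSubmodule) : H) from rfl, hc x₀']
    exact Submodule.smul_mem _ c (Submodule.subset_span ⟨i, rfl⟩)
  -- count: the `y_V` are linearly independent in the span of the `#I` vectors `z_i`
  have hli : LinearIndependent ℂ y := linearIndependent_of_ne_zero_of_inner_eq_zero hy0 hyorth
  haveI : FiniteDimensional ℂ (Submodule.span ℂ (Set.range z)) :=
    FiniteDimensional.span_of_finite ℂ (Set.finite_range z)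
  let y' : ↥s → Submodule.span ℂ (Set.range z) := fun V => ⟨y V, hmem V⟩
  have hli' : LinearIndependent ℂ y' :=
    LinearIndependent.of_comp (Submodule.span ℂ (Set.range z)).subtype hli
  have h1 := hli'.fintype_card_le_finrank
  rw [Fintype.card_coe] at h1
  exact h1.trans (finrank_range_le_card z)

/-- **The multiplicity is the number of equivalent summands** (Dixmier (1977), 5.4.6;
Deitmar–Echterhoff (2014), Thm. 9.2.2: in `H = ⊕̂ᵢ W i` "the multiplicities are uniquely
determined"). For a unitary `π`, an orthogonal decomposition `W : ι → ClosedSubrep π` into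
irreducibles (pairwise orthogonal, dense sum) and any representation `σ`, the multiplicity of `σ`
in `π` in the sense of `HilbertRepSpectrum` — the supremum of the sizes of finite orthogonal
families of irreducible closed subrepresentations equivalent to `σ` — equals the number, in `ℕ∞`,
of indices `i` with `W i ≃ σ` (`card_le_card_of_orthogonalDecomposition` and
`le_multiplicity_of_pairwise_isOrtho`). [cite: Dixmier1977, 5.4.6] -/
theorem IsUnitary.multiplicity_eq_card (hπ : π.IsUnitary) {W : ι → ClosedSubrep π}
    (hirr : ∀ i, (W i).toContRep.IsTopIrreducible)
    (horth : Pairwise fun i j => (W i).toSubmodule ⟂ (W j).toSubmodule)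
    (hdense : (⨆ i, (W i).toSubmodule)ᗮ = ⊥)
    {H' : Type*} [SeminormedAddCommGroup H'] [Module ℂ H'] (σ : ContRepresentation ℂ G H') :
    π.multiplicity σ = ENat.card {i // AreUnitarilyEquivalent (W i).toContRep σ} := by
  classical
  rcases finite_or_infinite {i // AreUnitarilyEquivalent (W i).toContRep σ} with hfin | hinf
  · haveI := Fintype.ofFinite {i // AreUnitarilyEquivalent (W i).toContRep σ}
    rw [ENat.card_eq_coe_fintype_card]
    apply le_antisymm
    · unfold multiplicity
      refine iSup_le fun s => iSup_le fun hs => iSup_le fun ho => ?_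
      exact_mod_cast hπ.card_le_card_of_orthogonalDecomposition hirr horth hdense σ s hs ho
    · have h := le_multiplicity_of_pairwise_isOrtho (π := π) hirr horth (σ := σ)
        ((Finset.univ : Finset {i // AreUnitarilyEquivalent (W i).toContRep σ}).map
          (Function.Embedding.subtype _))
        (fun i hi => by
          obtain ⟨i', -, rfl⟩ := Finset.mem_map.mp hi
          exact i'.2)
      rwa [Finset.card_map, Finset.card_univ] at h
  · rw [ENat.card_eq_top_of_infinite]
    refine ENat.eq_top_iff_forall_ge.mpr fun n => ?_
    obtain ⟨F, hF⟩ :=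
      Infinite.exists_subset_card_eq {i // AreUnitarilyEquivalent (W i).toContRep σ} n
    have h := le_multiplicity_of_pairwise_isOrtho (π := π) hirr horth (σ := σ)
      (F.map (Function.Embedding.subtype _))
      (fun i hi => by
        obtain ⟨i', -, rfl⟩ := Finset.mem_map.mp hi
        exact i'.2)
    rwa [Finset.card_map, hF] at h

/-- **The number of summands equivalent to `σ` does not depend on the orthogonal decomposition**
(Dixmier (1977), 5.4.6; Deitmar–Echterhoff (2014), Thm. 9.2.2). [cite: Dixmier1977, 5.4.6] -/
theorem IsUnitary.card_eq_card_of_orthogonalDecomposition (hπ : π.IsUnitary) {ι' : Type*}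
    {W : ι → ClosedSubrep π} {W' : ι' → ClosedSubrep π}
    (hirr : ∀ i, (W i).toContRep.IsTopIrreducible)
    (horth : Pairwise fun i j => (W i).toSubmodule ⟂ (W j).toSubmodule)
    (hdense : (⨆ i, (W i).toSubmodule)ᗮ = ⊥)
    (hirr' : ∀ i, (W' i).toContRep.IsTopIrreducible)
    (horth' : Pairwise fun i j => (W' i).toSubmodule ⟂ (W' j).toSubmodule)
    (hdense' : (⨆ i, (W' i).toSubmodule)ᗮ = ⊥)
    {H' : Type*} [SeminormedAddCommGroup H'] [Module ℂ H'] (σ : ContRepresentation ℂ G H') :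
    ENat.card {i // AreUnitarilyEquivalent (W i).toContRep σ} =
      ENat.card {i // AreUnitarilyEquivalent (W' i).toContRep σ} := by
  rw [← hπ.multiplicity_eq_card hirr horth hdense σ, hπ.multiplicity_eq_card hirr' horth' hdense' σ]

/-- The multiplicity of a summand `W i₀` is the number of summands equivalent to it; in
particular it is `≥ 1`. [cite: Dixmier1977, 5.4.6] -/
theorem IsUnitary.one_le_multiplicity_of_orthogonalDecomposition (hπ : π.IsUnitary)
    {W : ι → ClosedSubrep π} (hirr : ∀ i, (W i).toContRep.IsTopIrreducible)
    (horth : Pairwise fun i j => (W i).toSubmodule ⟂ (W j).toSubmodule)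
    (hdense : (⨆ i, (W i).toSubmodule)ᗮ = ⊥) (i₀ : ι) :
    1 ≤ π.multiplicity (W i₀).toContRep := by
  rw [hπ.multiplicity_eq_card hirr horth hdense (W i₀).toContRep, ENat.one_le_card_iff_nonempty]
  exact ⟨⟨i₀, AreUnitarilyEquivalent.refl _⟩⟩

/-! ### Multiplicity one in terms of a decomposition -/

/-- **`π` has multiplicity one iff the members of an orthogonal decomposition into irreducibles
are pairwise inequivalent** (for unitary `π`; with `multiplicity_eq_card` and the tree's
`hasMultiplicityOne_iff_multiplicity_le_one_holds`, Deitmar–Echterhoff (2014), Cor. 6.1.9). This is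
the form in which a trace formula delivers multiplicity one: Gelbart (1975), proof of Thm. 10.10,
p. 158, "if `π'` occurs twice [in the decomposition `R'_ψ = ⊕ π^j`] then …".
[cite: Gelbart1975, Thm. 10.10 (proof, p. 158)] [cite: Dixmier1977, 5.4.6] -/
theorem IsUnitary.hasMultiplicityOne_iff_pairwise_not_areUnitarilyEquivalent (hπ : π.IsUnitary)
    {W : ι → ClosedSubrep π} (hirr : ∀ i, (W i).toContRep.IsTopIrreducible)
    (horth : Pairwise fun i j => (W i).toSubmodule ⟂ (W j).toSubmodule)
    (hdense : (⨆ i, (W i).toSubmodule)ᗮ = ⊥) :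
    π.HasMultiplicityOne ↔
      Pairwise fun i j => ¬ AreUnitarilyEquivalent (W i).toContRep (W j).toContRep := by
  constructor
  · intro h i j hne he
    exact hne (ClosedSubrep.injective_of_pairwise_isOrtho hirr horth
      (h (W i) (W j) (hirr i) (hirr j) he))
  · intro h
    rw [hasMultiplicityOne_iff_multiplicity_le_one_holds hπ]
    intro V _
    rw [hπ.multiplicity_eq_card hirr horth hdense V.toContRep]
    refine (ENat.card_le_one_iff_subsingleton _).mpr ⟨fun i j => Subtype.ext ?_⟩
    by_contra hne
    exact h hne (i.2.trans j.2.symm)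

/-! ### Set-indexed decompositions (the output of `exists_orthogonalDecomposition`) -/

/-- For a set `S` of closed subrepresentations with closed span `H`, the sum of the members of
`S`, indexed by `S` itself, has zero orthogonal complement. [folklore] -/
theorem ClosedSubrep.orthogonal_iSup_eq_bot_of_iSupClosure_eq_top {S : Set (ClosedSubrep π)}
    (h : ClosedSubrep.iSupClosure S = ⊤) :
    (⨆ W : S, (W : ClosedSubrep π).toSubmodule)ᗮ = ⊥ := by
  have e : (⨆ W : S, (W : ClosedSubrep π).toSubmodule) =
      ⨆ W ∈ S, (W : ClosedSubrep π).toSubmodule :=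
    iSup_subtype'' S fun W : ClosedSubrep π => W.toSubmodule
  rw [e]
  exact (ClosedSubrep.iSupClosure_eq_top_iff S).mp h

omit [CompleteSpace H] in
/-- `S.Pairwise` orthogonality as `Pairwise` orthogonality of the family indexed by `S`.
[folklore] -/
theorem ClosedSubrep.pairwise_subtype_isOrtho {S : Set (ClosedSubrep π)}
    (h : S.Pairwise fun W W' => W.toSubmodule ⟂ W'.toSubmodule) :
    Pairwise fun W W' : S => (W : ClosedSubrep π).toSubmodule ⟂ (W' : ClosedSubrep π).toSubmodule :=
  (pairwise_subtype_iff_pairwise_set S fun W W' => W.toSubmodule ⟂ W'.toSubmodule).mpr h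

/-- **Multiplicity as a count, for a set-indexed decomposition**: if `S` is a set of pairwise
orthogonal irreducible closed subrepresentations of the unitary `π` with closed span `H`, then
`multiplicity π σ = #{W ∈ S | W ≃ σ}`. [cite: Dixmier1977, 5.4.6] -/
theorem IsUnitary.multiplicity_eq_card_of_set (hπ : π.IsUnitary) {S : Set (ClosedSubrep π)}
    (hirr : ∀ W ∈ S, W.toContRep.IsTopIrreducible)
    (horth : S.Pairwise fun W W' => W.toSubmodule ⟂ W'.toSubmodule)
    (hdense : ClosedSubrep.iSupClosure S = ⊤)
    {H' : Type*} [SeminormedAddCommGroup H'] [Module ℂ H'] (σ : ContRepresentation ℂ G H') :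
    π.multiplicity σ =
      ENat.card {W : S // AreUnitarilyEquivalent (W : ClosedSubrep π).toContRep σ} :=
  hπ.multiplicity_eq_card (W := fun W : S => (W : ClosedSubrep π)) (fun W => hirr W W.2)
    (ClosedSubrep.pairwise_subtype_isOrtho horth)
    (ClosedSubrep.orthogonal_iSup_eq_bot_of_iSupClosure_eq_top hdense) σ

/-- **Multiplicity one, for a set-indexed decomposition**: `π` has multiplicity one iff the
members of `S` are pairwise inequivalent. [cite: Dixmier1977, 5.4.6] -/
theorem IsUnitary.hasMultiplicityOne_iff_set_pairwise (hπ : π.IsUnitary) {S : Set (ClosedSubrep π)}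
    (hirr : ∀ W ∈ S, W.toContRep.IsTopIrreducible)
    (horth : S.Pairwise fun W W' => W.toSubmodule ⟂ W'.toSubmodule)
    (hdense : ClosedSubrep.iSupClosure S = ⊤) :
    π.HasMultiplicityOne ↔
      S.Pairwise fun W W' => ¬ AreUnitarilyEquivalent W.toContRep W'.toContRep := by
  rw [hπ.hasMultiplicityOne_iff_pairwise_not_areUnitarilyEquivalent
    (W := fun W : S => (W : ClosedSubrep π)) (fun W => hirr W W.2)
    (ClosedSubrep.pairwise_subtype_isOrtho horth)
    (ClosedSubrep.orthogonal_iSup_eq_bot_of_iSupClosure_eq_top hdense)]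
  exact pairwise_subtype_iff_pairwise_set S fun W W' =>
    ¬ AreUnitarilyEquivalent W.toContRep W'.toContRep

/-- **Multiplicity one via the existence of one good decomposition.** A unitary, discretely
decomposable `π` has multiplicity one iff it admits an orthogonal decomposition into pairwise
inequivalent irreducibles (`→`: any decomposition, which exists by
`exists_orthogonalDecomposition_of_isDiscretelyDecomposable`, will do; `←`:
`hasMultiplicityOne_iff_set_pairwise`). [cite: Dixmier1977, 5.4.6] -/
theorem IsUnitary.hasMultiplicityOne_iff_exists_orthogonalDecomposition (hπ : π.IsUnitary)
    (hd : π.IsDiscretelyDecomposable) :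
    π.HasMultiplicityOne ↔ ∃ S : Set (ClosedSubrep π), (∀ W ∈ S, W.toContRep.IsTopIrreducible) ∧
      S.Pairwise (fun W W' => W.toSubmodule ⟂ W'.toSubmodule) ∧ ClosedSubrep.iSupClosure S = ⊤ ∧
      S.Pairwise (fun W W' => ¬ AreUnitarilyEquivalent W.toContRep W'.toContRep) := by
  constructor
  · intro h
    obtain ⟨S, hirr, horth, hdense⟩ := hπ.exists_orthogonalDecomposition_of_isDiscretelyDecomposable hd
    exact ⟨S, hirr, horth, hdense, (hπ.hasMultiplicityOne_iff_set_pairwise hirr horth hdense).mp h⟩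
  · rintro ⟨S, hirr, horth, hdense, hne⟩
    exact (hπ.hasMultiplicityOne_iff_set_pairwise hirr horth hdense).mpr hne

/-- **Every irreducible closed subrepresentation is equivalent to a member of `S`** (set-indexed
form of `exists_areUnitarilyEquivalent_of_isTopIrreducible`). [cite: Dixmier1977, 5.4.4] -/
theorem IsUnitary.exists_mem_areUnitarilyEquivalent (hπ : π.IsUnitary) {S : Set (ClosedSubrep π)}
    (hirr : ∀ W ∈ S, W.toContRep.IsTopIrreducible) (hdense : ClosedSubrep.iSupClosure S = ⊤)
    {V : ClosedSubrep π} (hV : V.toContRep.IsTopIrreducible) :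
    ∃ W ∈ S, AreUnitarilyEquivalent V.toContRep W.toContRep := by
  obtain ⟨W, hW⟩ := hπ.exists_areUnitarilyEquivalent_of_isTopIrreducible
    (W := fun W : S => (W : ClosedSubrep π)) (fun W => hirr W W.2)
    (ClosedSubrep.orthogonal_iSup_eq_bot_of_iSupClosure_eq_top hdense) hV
  exact ⟨W, W.2, hW⟩

end Hilbert

end ContRepresentation
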